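import Summits.BirchSwinnertonDyer.BirchSwinnertonDyer.Theses.ThetaPartnerAtTwo
import Summits.BirchSwinnertonDyer.BirchSwinnertonDyer.Theorems.ThetaPartnerAtTwoMazurTateCongruenceAtTwoRIntegrality
import Summits.BirchSwinnertonDyer.Rank1Residual.Supersingular.MazurTateLayerConsistency
import HarnessLib

/-!
# Crux `MazurTateCongruenceAtTwoR` (stmt-BirchSwinnertonDyer-21416 = stub `stub_V2mtR` of K1 20333, line `bridge`)
# FOLLOWS FROM the Iwasawa-algebra-level congruence of the signed `2`-adic `L`-functions (GV shape)

Cell `bsd-wall`, seat `bsd-wall-tp2-p1-w2` (WIDTH seat on K1 `SignedTransportAtTwo`). THEOREMS ONLY (no `def`, no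
named fact, no `sorry`).

The crux `MazurTateCongruenceAtTwoR` asks, for a theta pair `(W, A)` with newforms `f, f_A`, period ratios `ϖ, ϖ_A`,
Pollack pairs at `2`, an admissible `S₀` and integral multiples `ι G = 2^m ϖ · ι L♭_W`, `ι G_A = 2^{m'} ϖ_A · ι L♭_A`
(`L♭ = kobayashiL 1 L⁺ L⁻ = L⁻`, Kobayashi's `L_p^+`), for ONE unit `u ∈ ℤ₂ˣ` such that at EVERY even layer `n`
`2^{m'}·(2^m ϖ θ_n(f) · E_{S₀}(W)) − u 2^m·(2^{m'} ϖ_A θ_n(f_A) · E_{S₀}(A)) ∈ ι((2^{m+m'+1}, ω_n)Λ)`,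
`E_{S₀} = eulerFactorProductInv`. We prove that it FOLLOWS from the single congruence IN `Λ`

  (GV2Λ)  `2^{m'} · G · E_{S₀}(W) − u · 2^m · G_A · E_{S₀}(A) ∈ 2^{m+m'+1} Λ`

— the congruence of the Néron-normalised, `S₀`-depleted Kobayashi-plus `2`-adic `L`-functions `ϖ L♭_W ∏𝒫` and
`ϖ_A L♭_A ∏𝒫` modulo `2Λ` up to a `2`-adic unit, i.e. Greenberg–Vatsal 2000 (13) / Vatsal 1999 Thm. (1.10) READ AT
`p = 2` for the signed theory — at every even layer and for every admissible `(G, m)`, `(G_A, m')`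
(`layer_congruence_two_of_lambda_congruence`, pointwise; `mazurTateCongruenceAtTwoR_of_lambdaCongruence`, the crux BY
NAME from the class-level hypothesis). The layer passage is the integrality transfer of
`ThetaPartnerAtTwoMazurTateCongruenceAtTwoRIntegrality` (`2^m ϖ θ_n(f) = ±ω_n^- G + ω_n ρ` with `ρ ∈ Λ`, from
Pollack's congruence `θ_n ≡ ±ω_n^- L⁻ (mod ω_n)` = the even clause of `IsPollackPair f 2 L⁺ L⁻`). Nothing about the truth
of (GV2Λ) is asserted: it is the research content of item 21416, now stated WITHOUT layers.

References: R. Greenberg, V. Vatsal, Invent. Math. 142 (2000) §3, (13) [GreenbergVatsal2000]; V. Vatsal, Duke Math. J.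
98 (1999) Thm. (1.10) [Vatsal1999]; R. Pollack, Duke Math. J. 118 (2003) Prop. 6.18 [Pollack2003].
-/

set_option linter.dupNamespace false
set_option autoImplicit false

noncomputable section

open scoped Classical MatrixGroups ModularForm

open CongruenceSubgroup Polynomial WeierstrassCurve NumberField IsDedekindDomain
  Literature.NumberTheory.EllipticCurves Literature.NumberTheory.EllipticCurves.ModularForms
  Literature.NumberTheory.EllipticCurves.Rank1Residual Literature.NumberTheory.EllipticCurves.GreenbergVatsal2000
  Literature.NumberTheory.EllipticCurves.Sprung2017
  Summit.BirchSwinnertonDyer.Rank1Residual.Supersingular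

namespace Summit.BirchSwinnertonDyer.BirchSwinnertonDyer.Theorems.MazurTateCongruenceAtTwoR

/-- The tree's two spellings of `ω_n ∈ Λ` agree: `toIwasawa p ω_n = ↑(ω_n.map (ℤ → ℤ_p))`. [folklore] -/
theorem toIwasawa_eq_coe_map {p : ℕ} [Fact p.Prime] (P : ℤ[X]) :
    toIwasawa p P = ((P.map (Int.castRingHom ℤ_[p]) : ℤ_[p][X]) : PowerSeries ℤ_[p]) := rfl

/-- **Pointwise: (GV2Λ) ⟹ the layer congruence at every even `n`.** For two weight-`2` cusp forms `f, f_A` (any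
levels) with Pollack pairs at `2`, integral multiples `ι G = 2^m ϖ ι L♭`, `ι G_A = 2^{m'} ϖ_A ι L♭_A`, depleting factors
`E, E_A ∈ Λ` and a unit `u` with `2^{m'} G E − u 2^m G_A E_A = 2^{m+m'+1} q₀` in `Λ`: at every even layer `n`,
`2^{m'}(2^m ϖ θ_n(f) E) − u 2^m (2^{m'} ϖ_A θ_n(f_A) E_A) = ι(2^{m+m'+1} q + ω_n r)` for some `q, r ∈ Λ` — the body of
`MazurTateCongruenceAtTwoR` at `(u, n)`. [cite: GreenbergVatsal2000, §3, (13)] [cite: Pollack2003, Prop. 6.18] -/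
theorem layer_congruence_two_of_lambda_congruence {N NA : ℕ} (f : CuspForm (Gamma0 N) 2)
    (fA : CuspForm (Gamma0 NA) 2) {Lplus Lminus LplusA LminusA : IwasawaAlgebra 2}
    (hPP : IsPollackPair f 2 Lplus Lminus) (hPPA : IsPollackPair fA 2 LplusA LminusA)
    {ϖ ϖA : ℚ} {G GA E EA : IwasawaAlgebra 2} {m m' : ℕ}
    (hG : iwasawaToPowerSeries 2 G =
      PowerSeries.C ((2 : ℚ_[2]) ^ m * (ϖ : ℚ_[2])) * iwasawaToPowerSeries 2 (kobayashiL 1 Lplus Lminus))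
    (hGA : iwasawaToPowerSeries 2 GA =
      PowerSeries.C ((2 : ℚ_[2]) ^ m' * (ϖA : ℚ_[2])) * iwasawaToPowerSeries 2 (kobayashiL 1 LplusA LminusA))
    {u : ℤ_[2]ˣ} {q₀ : IwasawaAlgebra 2}
    (hΛ : PowerSeries.C ((2 : ℤ_[2]) ^ m') * G * E - PowerSeries.C ((u : ℤ_[2]) * (2 : ℤ_[2]) ^ m) * GA * EA =
      PowerSeries.C ((2 : ℤ_[2]) ^ (m + m' + 1)) * q₀)
    {n : ℕ} (hn : Even n) :
    ∃ q r : IwasawaAlgebra 2,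
      PowerSeries.C (((2 : ℤ_[2]) ^ m' : ℤ_[2]) : ℚ_[2]) *
          (PowerSeries.C ((2 : ℚ_[2]) ^ m * (ϖ : ℚ_[2])) *
            ((mazurTateElement f 2 n).map (algebraMap ℚ ℚ_[2]) : PowerSeries ℚ_[2]) *
            iwasawaToPowerSeries 2 E) -
        PowerSeries.C (((u : ℤ_[2]) * (2 : ℤ_[2]) ^ m : ℤ_[2]) : ℚ_[2]) *
          (PowerSeries.C ((2 : ℚ_[2]) ^ m' * (ϖA : ℚ_[2])) *
            ((mazurTateElement fA 2 n).map (algebraMap ℚ ℚ_[2]) : PowerSeries ℚ_[2]) *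
            iwasawaToPowerSeries 2 EA) =
      iwasawaToPowerSeries 2
        (PowerSeries.C ((2 : ℤ_[2]) ^ (m + m' + 1)) * q + toIwasawa 2 (cyclotomicOmega 2 n) * r) := by
  have hK : kobayashiL (1 : ℤˣ) Lplus Lminus = Lminus := if_pos rfl
  have hKA : kobayashiL (1 : ℤˣ) LplusA LminusA = LminusA := if_pos rfl
  rw [hK] at hG
  rw [hKA] at hGA
  rw [toIwasawa_eq_coe_map]
  exact exists_layer_congruence_of_lambda_congruence (hPP.2.2.2 n hn) (hPPA.2.2.2 n hn)
    (natDegree_mazurTateElement_lt f 2 n) (natDegree_mazurTateElement_lt fA 2 n) hG hGA hΛ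

/-- **The crux `MazurTateCongruenceAtTwoR` (item 21416) BY NAME from the Iwasawa-algebra-level congruence (GV2Λ).**
Hypothesis: for every theta pair and every admissible datum exactly as in the crux, ONE congruence in `Λ`,
`∃ u ∈ ℤ₂ˣ, 2^{m'} · G · E_{S₀}(W) − u · 2^m · G_A · E_{S₀}(A) ∈ 2^{m+m'+1} Λ` (Greenberg–Vatsal (13) / Vatsal (1.10)
READ AT `2` for Kobayashi's `L_p^+`, Néron-normalised and `S₀`-depleted by `eulerFactorProductInv`). Conclusion: the crux —
the same `u` works at every even layer. Nothing asserted about the hypothesis (research, unpublished at `p = 2`).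
[cite: GreenbergVatsal2000, §3, (13)] [cite: Vatsal1999, Thm. (1.10)] [cite: Pollack2003, Prop. 6.18] -/
theorem mazurTateCongruenceAtTwoR_of_lambdaCongruence
    (hΛ : ∀ (W : WeierstrassCurve ℚ) [W.IsElliptic] [W.IsGloballyMinimal] (A : WeierstrassCurve ℚ) [A.IsElliptic]
      [A.IsGloballyMinimal], ¬ W.HasCM → W.analyticRank = 0 → GoodSS W 2 → W.frobeniusTrace 2 = 0 → A.HasCM →
      GoodSS A 2 → A.frobeniusTrace 2 = 0 →
      (∃ e : WeierstrassCurve.geomTorsion W (2 : ℤ) ≃+ WeierstrassCurve.geomTorsion A (2 : ℤ),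
        ∀ (σ : Field.absoluteGaloisGroup ℚ) (P : WeierstrassCurve.geomTorsion W (2 : ℤ)), e (σ • P) = σ • e P) →
      ∀ (γ : Field.absoluteGaloisGroup ℚ), IsCyclotomicVariable 2 γ →
      ∀ [NeZero (W.conductorNorm ℤ)] (f : CuspForm (Gamma0 (W.conductorNorm ℤ)) 2), IsNewformOf W f →
      ∀ (ϖ : ℚ), (ϖ : ℝ) * W.realPeriodRat = plusPeriod f →
      ∀ (Lplus Lminus : IwasawaAlgebra 2), IsPollackPair f 2 Lplus Lminus →
      ∀ [NeZero (A.conductorNorm ℤ)] (fA : CuspForm (Gamma0 (A.conductorNorm ℤ)) 2), IsNewformOf A fA →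
      ∀ (ϖA : ℚ), (ϖA : ℝ) * A.realPeriodRat = plusPeriod fA →
      ∀ (LplusA LminusA : IwasawaAlgebra 2), IsPollackPair fA 2 LplusA LminusA →
      ∀ (S₀ : Finset (HeightOneSpectrum (𝓞 ℚ))), (∀ v ∈ S₀, ((2 : ℕ) : 𝓞 ℚ) ∉ v.asIdeal) →
        (∀ v : HeightOneSpectrum (𝓞 ℚ), ¬ W.HasGoodReductionAt v → v ∈ S₀) →
        (∀ v : HeightOneSpectrum (𝓞 ℚ), ¬ A.HasGoodReductionAt v → v ∈ S₀) →
      ∀ (G : IwasawaAlgebra 2) (m : ℕ), iwasawaToPowerSeries 2 G =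
          PowerSeries.C ((2 : ℚ_[2]) ^ m * (ϖ : ℚ_[2])) * iwasawaToPowerSeries 2 (kobayashiL 1 Lplus Lminus) →
      ∀ (GA : IwasawaAlgebra 2) (m' : ℕ), iwasawaToPowerSeries 2 GA =
          PowerSeries.C ((2 : ℚ_[2]) ^ m' * (ϖA : ℚ_[2])) * iwasawaToPowerSeries 2 (kobayashiL 1 LplusA LminusA) →
      ∃ (u : ℤ_[2]ˣ) (q₀ : IwasawaAlgebra 2),
        PowerSeries.C ((2 : ℤ_[2]) ^ m') * G * eulerFactorProductInv W 2 S₀ -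
            PowerSeries.C ((u : ℤ_[2]) * (2 : ℤ_[2]) ^ m) * GA * eulerFactorProductInv A 2 S₀ =
          PowerSeries.C ((2 : ℤ_[2]) ^ (m + m' + 1)) * q₀) :
    Summit.BirchSwinnertonDyer.BirchSwinnertonDyer.Theses.ThetaPartnerAtTwo.MazurTateCongruenceAtTwoR := by
  intro W _ _ A _ _ hcm hr hss ha hAcm hAss hAa he γ hγ _ f hf ϖ hϖ Lplus Lminus hPP _ fA hfA ϖA hϖA LplusA LminusA
    hPPA S₀ hS2 hSW hSA G m hG GA m' hGA
  obtain ⟨u, q₀, hq₀⟩ := hΛ W A hcm hr hss ha hAcm hAss hAa he γ hγ f hf ϖ hϖ Lplus Lminus hPP fA hfA ϖA hϖA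
    LplusA LminusA hPPA S₀ hS2 hSW hSA G m hG GA m' hGA
  exact ⟨u, fun n hn ↦ layer_congruence_two_of_lambda_congruence f fA hPP hPPA hG hGA hq₀ hn⟩

end Summit.BirchSwinnertonDyer.BirchSwinnertonDyer.Theorems.MazurTateCongruenceAtTwoR

end
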